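import Summits.QuantumAdvantage.QuantumAdvantage.Theorems.ResponseDialG

/-! # ResponseDialHA — ResponseDial REV 1 delta part 4/6 (mechanical split for landing; content verbatim; scopes re-opened with their variables) -/

set_option linter.dupNamespace false
noncomputable section
open scoped Classical

namespace Summit.QuantumAdvantage.QuantumAdvantage.Theorems.ResponseDial
open Finset
open Literature.Computability.QuantumComplexity Literature.Computability.QuantumComplexity.RingHLF
open Literature.Computability.MetaComplexity Literature.Computability.MetaComplexity.Smolensky
open Summit.QuantumAdvantage.AdviceFreeQNC0
open Summit.QuantumAdvantage.QuantumAdvantage.Theorems.AnchorDial (outB dev cN orbF orbL orbL_cons fz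
  cN_orbF_cast oddZeros_orbF win_iff gCond_iff_cN card_filter_orbF orbF_false flip2 card_odd_ge loss_shape_mono)
open Summit.QuantumAdvantage.QuantumAdvantage.Theorems.AnchorDial.Core (ct sg)
open Summit.QuantumAdvantage.QuantumAdvantage.Theorems.HolonomyDial (gCond tPoly tPoly_apply tPoly_mem card_odd_le
  xorP xorP_mem xorP_apply_bool mono_singleton_apply indP indP_mem indP_apply)
open Summit.QuantumAdvantage.QuantumAdvantage.Theorems.StabilizerDial (apIdx apStrat apStrat_mem bitP bitP_apStrat
  pad rel_pad_iff outB_pad_zero pad_mem StabFew rowMask bitP_pad mem_dev_pad_apStrat_iff BlockRec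
  blockSelect_of_fewLocus goodBound_of_blockRec fibreIdentityAt_of_block oddSliceBound_holds eventually_polylog
  side_bounds)
open Summit.QuantumAdvantage.QuantumAdvantage.Theorems.LocusDial (Coverable FewLocus)
open Summit.QuantumAdvantage.QuantumAdvantage.Theorems.SparsityDial (real_loss_of_frac AntipodalLoss3 stabFew_mono_mr
  one_le_logpow)
open Summit.QuantumAdvantage.QuantumAdvantage.Theses.SparsityDial (DenseGenericLoss3)

/-! ## §11  The third named instance: the MULTI-COUNTER family (rung `MultiCounterLoss3`, PROVED in §12).
Position `k` of the second half-cycle toggles the canonical guess by ITS OWN mod-3 counter over the odd cells of the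
half-cycle window `[k − N/2, k)`; the first half-cycle is the antipodal pointer (so the family is certified dense by
`not_polylogSparse_of_agree`).  It responds neither additively nor by a common counter; §12 decides it all the same. -/

section MultiCounter
variable {N : ℕ}

/-- the window counter of position `k`: the odd cells of `[k − N/2, k)`, summed in `𝔽₃` (degree 1). -/
def loddW (k : Fin N) : CubeFn (ZMod 3) N :=
  ∑ i ∈ (univ : Finset (Fin N)).filter (fun i => i.val % 2 = 1 ∧ k.val - N / 2 ≤ i.val ∧ i.val < k.val),
    mono (ZMod 3) {i}

/-- ResponseDialHA helper `loddW_mem` (decomp-qadv land package; see the module docstring). -/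
theorem loddW_mem (k : Fin N) : loddW k ∈ lowDeg (ZMod 3) N 1 :=
  Submodule.sum_mem _ fun _ _ => mono_mem_lowDeg (Finset.card_singleton _).le

/-- **THE MULTI-COUNTER FAMILY** (degree 4). -/
def mcStrat (k : Fin N) : CubeFn (ZMod 3) N :=
  if 1 ≤ k.val ∧ k.val < N / 2 then apStrat k else xorP (tPoly k) (indP (loddW k) 0)

/-- ResponseDialHA helper `mcStrat_mem` (decomp-qadv land package; see the module docstring). -/
theorem mcStrat_mem (k : Fin N) : mcStrat k ∈ lowDeg (ZMod 3) N 4 := by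
  unfold mcStrat
  split_ifs
  · exact lowDeg_mono (by norm_num) (apStrat_mem k)
  · have h : xorP (tPoly k) (indP (loddW k) 0) ∈ lowDeg (ZMod 3) N (2 + 2) :=
      xorP_mem (tPoly_mem k) (indP_mem (loddW_mem k) 0)
    exact lowDeg_mono (by norm_num) h

/-- ResponseDialHA helper `mcStrat_agree` (decomp-qadv land package; see the module docstring). -/
theorem mcStrat_agree (j : Fin N) (h1 : 1 ≤ j.val) (h2 : j.val < N / 2) : mcStrat j = apStrat j := by
  unfold mcStrat; rw [if_pos ⟨h1, h2⟩]

/-- CERTIFIED DENSE: the multi-counter family is not cheaply `(log₂ n)^a`-point-sparsifiable, at any level. -/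
theorem mcStrat_not_polylogSparse (a e : ℕ) :
    ∃ n₀ : ℕ, ∀ n ≥ n₀, ¬ StabFew ((Nat.log 2 n) ^ a) 0 e (fun j : Fin n => mcStrat j) := by
  have hag : ∀ (n : ℕ) (j : Fin n), 1 ≤ j.val → j.val < n / 2 →
      (fun (n : ℕ) (j : Fin n) => (mcStrat j : CubeFn (ZMod 3) n)) n j = apStrat j :=
    fun n j h1 h2 => mcStrat_agree j h1 h2
  obtain ⟨n₀, hn₀⟩ := not_polylogSparse_of_agree (fun (n : ℕ) (j : Fin n) => (mcStrat j : CubeFn (ZMod 3) n)) hag a e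
  exact ⟨n₀, fun n hn => hn₀ n hn⟩

/-- hence it inhabits `DenseGenericLoss3`'s hypothesis class at every scale (degree `4 ≤ (log₂ n)^c`, `c ≥ 1`). -/
theorem mcStrat_in_dense_class (a c : ℕ) (hc : 1 ≤ c) :
    ∃ n₀ : ℕ, ∀ n ≥ n₀, (∀ i : Fin n, mcStrat i ∈ lowDeg (ZMod 3) n ((Nat.log 2 n) ^ c)) ∧
      ¬ StabFew ((Nat.log 2 n) ^ a) 0 (c + 1) (fun j : Fin n => mcStrat j) := by
  obtain ⟨n₀, hn₀⟩ := mcStrat_not_polylogSparse a (c + 1)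
  refine ⟨max n₀ 16, fun n hn => ⟨fun i => ?_, hn₀ n (le_trans (le_max_left _ _) hn)⟩⟩
  have h16 : 2 ^ 4 ≤ n := le_trans (le_max_right _ _) hn
  have hL : 4 ≤ Nat.log 2 n := Nat.le_log_of_pow_le (by norm_num) h16
  have h4 : 4 ≤ (Nat.log 2 n) ^ c :=
    calc 4 ≤ Nat.log 2 n := hL
      _ = (Nat.log 2 n) ^ 1 := (pow_one _).symm
      _ ≤ (Nat.log 2 n) ^ c := Nat.pow_le_pow_right (by omega) hc
  exact lowDeg_mono h4 (mcStrat_mem i)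

/-- **the residual's third rung** (PROVED below, `multiCounterLoss3`): the multi-counter family loses a polynomial
fraction. -/
def MultiCounterLoss3 : Prop :=
  ∃ C n₀ : ℕ, ∀ n ≥ n₀,
    ((univ.filter fun x : Fin n → Bool => OddZeros x ∧ Rel x (fun i => decide (mcStrat i x = 1))).card : ℝ)
      ≤ (1 - 1 / (n : ℝ) ^ C) * (2 : ℝ) ^ (n - 1)

/-- `DenseGenericLoss3 ⟹ MultiCounterLoss3` (at `a = 1`, `c = 1`): the target speaks about the family. -/
theorem multiCounterLoss3_of_dense (hD : DenseGenericLoss3) : MultiCounterLoss3 := by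
  obtain ⟨a, C, h⟩ := hD
  obtain ⟨n₁, hn₁⟩ := h 1
  obtain ⟨n₂, hn₂⟩ := mcStrat_in_dense_class a 1 le_rfl
  refine ⟨C, max n₁ n₂, fun n hn => ?_⟩
  obtain ⟨hdeg, hgen⟩ := hn₂ n (le_trans (le_max_right _ _) hn)
  exact hn₁ n (le_trans (le_max_left _ _) hn) _ hdeg hgen

end MultiCounter


/-! ## §12  THE MULTI-COUNTER LAW: the rung `MultiCounterLoss3` is a THEOREM as well.
With the five flip sites in the FIRST half-cycle (`2, 6, 10, 14, 18`) the first-half pointer readers of the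
multi-counter family are FROZEN along the orbit, and each second-half position `k` toggles by the counter of the flipped
odd cells inside its window — a SUFFIX of the five sites (those `i` with `k − N/2 ≤ 4i + 3`), with position-dependent
base `loddW k x`.  The orbit system is then orthogonal-certifiable against ALL (threshold, base, phase) triples at once
for the 12 sign vectors with exactly two sign changes among sites 1–4, and conditioning 14 cells forces the pattern
`(z₀, a, ¬a, ¬a, a)` (`certM`: weight-11 certificates, `decide`d).  Hence `#odd ≤ 2²⁰ · #{odd losers}` and
`MultiCounterLoss3` with `C = 1` (`multiCounterLoss3`).  With the sites at the END of the cycle instead (pointer readers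
and prefix counters both live) NO certificate exists at any datum (scratch `mc_check4.py`): what the method needs is a
site placement that FREEZES the response-diverse part, not response-poverty outright. -/

section MultiCounterLaw
variable {N : ℕ}

/-- the window-counter bit of position `k`. -/
def qbitW (k : Fin N) (x : Fin N → Bool) : Bool := decide ((loddW k) x = 0)

/-- ResponseDialHA helper `indP_loddW_apply` (decomp-qadv land package; see the module docstring). -/
theorem indP_loddW_apply (k : Fin N) (x : Fin N → Bool) :
    (indP (loddW k) 0) x = if qbitW k x then 1 else 0 := by
  unfold qbitW; rw [indP_apply]; by_cases h : (loddW k) x = 0 <;> simp [h]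

/-- off the first half, position `k` of the multi-counter family deviates iff its window-counter bit is set. -/
theorem mem_dev_mcStrat_iff (x : Fin N → Bool) (j : Fin N) (hj : ¬ (1 ≤ j.val ∧ j.val < N / 2)) :
    j ∈ dev (fun i : Fin N => mcStrat i) x ↔ qbitW j x = true := by
  have happ : mcStrat j x = if xor (tGuess x j) (qbitW j x) then 1 else 0 := by
    unfold mcStrat; rw [if_neg hj]
    exact xorP_apply_bool _ _ x _ _ (tPoly_apply j x) (indP_loddW_apply j x)
  simp only [Summit.QuantumAdvantage.QuantumAdvantage.Theorems.AnchorDial.dev, mem_filter, mem_univ, true_and, happ]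
  generalize tGuess x j = t; generalize qbitW j x = q
  cases t <;> cases q <;> decide

/-- ResponseDialHA helper `mem_dev_mc_first` (decomp-qadv land package; see the module docstring). -/
theorem mem_dev_mc_first (y : Fin N → Bool) (k : Fin N) (hk : 1 ≤ k.val ∧ k.val < N / 2) :
    k ∈ dev (fun i : Fin N => mcStrat i) y ↔ y (apIdx k) = true := by
  have h := mem_dev_apStrat y k
  unfold Summit.QuantumAdvantage.QuantumAdvantage.Theorems.AnchorDial.dev at h ⊢
  rw [mem_filter] at h ⊢
  have e : (fun i : Fin N => mcStrat i) k y = (fun i : Fin N => apStrat i) k y := by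
    show mcStrat k y = apStrat k y
    rw [mcStrat_agree k hk.1 hk.2]
  rw [e]
  exact h

/-- ResponseDialHA helper `loddW_eq_sum` (decomp-qadv land package; see the module docstring). -/
theorem loddW_eq_sum (k : Fin N) (x : Fin N → Bool) :
    (loddW k) x = ∑ j ∈ (univ : Finset (Fin N)).filter
      (fun j => j.val % 2 = 1 ∧ k.val - N / 2 ≤ j.val ∧ j.val < k.val), (if x j then (1 : ZMod 3) else 0) := by
  unfold loddW; rw [Finset.sum_apply]; exact sum_congr rfl fun j _ => mono_singleton_apply j x

/-- how a window counter moves along a pair-flip orbit: by the signs of the flipped odd cells inside the window. -/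
theorem loddW_orbF {b : Fin 5 → ℕ} (hb : ∀ i j : Fin 5, i < j → b i + 2 ≤ b j) (hbN : ∀ i, b i + 3 ≤ N)
    (k : Fin N) (ε : Fin 5 → Bool) (x : Fin N → Bool) :
    (loddW k) (orbF b ε x) = (loddW k) x +
      ∑ i ∈ (univ : Finset (Fin 5)).filter (fun i => ε i = true ∧
        (k.val - N / 2 ≤ (oddSite hbN i).val ∧ (oddSite hbN i).val < k.val)), sgn3 (x (oddSite hbN i)) := by
  rw [loddW_eq_sum, loddW_eq_sum]
  have hpt : ∀ j ∈ (univ : Finset (Fin N)).filter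
      (fun j => j.val % 2 = 1 ∧ k.val - N / 2 ≤ j.val ∧ j.val < k.val),
      (if orbF b ε x j then (1 : ZMod 3) else 0) =
        (if x j then (1 : ZMod 3) else 0) +
          (if (∃ i, ε i = true ∧ (j.val = b i ∨ j.val = b i + 1)) then sgn3 (x j) else 0) := by
    intro j _
    rw [orbF_apply hb ε x j]
    by_cases h : ∃ i, ε i = true ∧ (j.val = b i ∨ j.val = b i + 1)
    · rw [if_pos h, if_pos h]; unfold sgn3; cases x j <;> decide
    · rw [if_neg h, if_neg h, add_zero]
  rw [sum_congr rfl hpt, sum_add_distrib]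
  congr 1
  have hset : ((univ : Finset (Fin N)).filter
      (fun j => j.val % 2 = 1 ∧ k.val - N / 2 ≤ j.val ∧ j.val < k.val)).filter
      (fun j => ∃ i, ε i = true ∧ (j.val = b i ∨ j.val = b i + 1)) =
        ((univ : Finset (Fin 5)).filter (fun i => ε i = true ∧
          (k.val - N / 2 ≤ (oddSite hbN i).val ∧ (oddSite hbN i).val < k.val))).image (oddSite hbN) := by
    ext j
    simp only [mem_filter, mem_univ, true_and, mem_image]
    constructor
    · rintro ⟨⟨hodd, hw⟩, i, hi, hj⟩
      have hji : oddSite hbN i = j := by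
        refine Fin.ext ?_
        have h1 := oddSite_val hbN i
        have h2 := oddSite_odd hbN i
        rcases hj with hj | hj <;> rcases h1 with h1 | h1 <;> omega
      refine ⟨i, ⟨hi, ?_⟩, hji⟩
      rw [hji]; exact hw
    · rintro ⟨i, ⟨hi, hw⟩, rfl⟩
      exact ⟨⟨oddSite_odd hbN i, hw⟩, i, hi, oddSite_val hbN i⟩
  rw [← sum_filter, hset, sum_image]
  intro i₁ hi₁ i₂ hi₂ heq
  by_contra hne
  have hv := congrArg Fin.val heq
  have h1 := oddSite_val hbN i₁
  have h2 := oddSite_val hbN i₂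
  rcases lt_or_gt_of_ne hne with hlt | hlt
  · have := hb i₁ i₂ hlt; omega
  · have := hb i₂ i₁ hlt; omega

/-- the orbit increment of position `k`'s window counter (first-half sites). -/
def wsum (hbN : ∀ i : Fin 5, hcSite i + 3 ≤ N) (x : Fin N → Bool) (k : Fin N) (ε : Fin 5 → Bool) : ZMod 3 :=
  ∑ i ∈ (univ : Finset (Fin 5)).filter (fun i => ε i = true ∧
    (k.val - N / 2 ≤ (oddSite hbN i).val ∧ (oddSite hbN i).val < k.val)), sgn3 (x (oddSite hbN i))

/-- the window count at threshold `t` when every flipped odd cell holds `0` (explicit five-term form, for `decide`). -/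
def cntT5 (t : ℕ) (ε : Fin 5 → Bool) : ZMod 3 :=
  (if ε 0 = true ∧ t ≤ 4 * (0 : Fin 5).val + 3 then 1 else 0) +
    (if ε 1 = true ∧ t ≤ 4 * (1 : Fin 5).val + 3 then 1 else 0) +
    (if ε 2 = true ∧ t ≤ 4 * (2 : Fin 5).val + 3 then 1 else 0) +
    (if ε 3 = true ∧ t ≤ 4 * (3 : Fin 5).val + 3 then 1 else 0) +
    (if ε 4 = true ∧ t ≤ 4 * (4 : Fin 5).val + 3 then 1 else 0)

/-- ResponseDialHA helper `cntT5_eq_sum` (decomp-qadv land package; see the module docstring). -/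
theorem cntT5_eq_sum (t : ℕ) (ε : Fin 5 → Bool) :
    cntT5 t ε = ∑ i : Fin 5, (if ε i = true ∧ t ≤ 4 * i.val + 3 then (1 : ZMod 3) else 0) := by
  rw [Fin.sum_univ_five]; rfl

/-- ResponseDialHA helper `wsum_eq` (decomp-qadv land package; see the module docstring). -/
theorem wsum_eq (hN : 40 ≤ N) (x : Fin N → Bool) (hx0 : ∀ i : Fin 5, x (oddSite (hcSite_le (by omega)) i) = false)
    (k : Fin N) (hk : N / 2 ≤ k.val) (ε : Fin 5 → Bool) :
    wsum (hcSite_le (by omega)) x k ε = cntT5 (min (k.val - N / 2) 20) ε := by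
  have hv : ∀ i : Fin 5, (oddSite (hcSite_le (N := N) (by omega)) i).val = 4 * i.val + 3 :=
    oddSite_hcSite _
  unfold wsum
  rw [sum_filter, cntT5_eq_sum]
  refine sum_congr rfl fun i _ => ?_
  rw [hx0 i, sgn3_false]
  have hw : (k.val - N / 2 ≤ (oddSite (hcSite_le (N := N) (by omega)) i).val ∧
      (oddSite (hcSite_le (N := N) (by omega)) i).val < k.val) ↔ min (k.val - N / 2) 20 ≤ 4 * i.val + 3 := by
    rw [hv i]; have := i.isLt; constructor
    · intro h; omega
    · intro h; omega
  exact if_congr (and_congr_right fun _ => hw) rfl rfl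

/-- ResponseDialHA helper `loddW_apply_zero` (decomp-qadv land package; see the module docstring). -/
theorem loddW_apply_zero (k : Fin N) (hk : k.val = 0) (y : Fin N → Bool) : (loddW k) y = 0 := by
  rw [loddW_eq_sum]
  refine sum_eq_zero fun j hj => ?_
  rw [mem_filter] at hj
  omega

/-- ResponseDialHA helper `wsum_zero` (decomp-qadv land package; see the module docstring). -/
theorem wsum_zero (hbN : ∀ i : Fin 5, hcSite i + 3 ≤ N) (x : Fin N → Bool) (k : Fin N) (hk : k.val = 0)
    (ε : Fin 5 → Bool) : wsum hbN x k ε = 0 := by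
  unfold wsum
  refine sum_eq_zero fun i hi => ?_
  rw [mem_filter] at hi
  omega

/-- the multi-counter certificates (indexed by `z₀` and `a`; sign pattern `(z₀, a, ¬a, ¬a, a)`). -/
def certM : Bool → Bool → ℕ
  | false, false => 1611513088
  | false, true => 2416868864
  | true, false => 2416868864
  | true, true => 1611513088

/-- ResponseDialHA helper `lamM` (decomp-qadv land package; see the module docstring). -/
def lamM (z : Fin 5 → Bool) : List ℕ := (List.range 32).filter fun j => (certM (z 0) (z 1)).testBit j

/-- what a multi-counter certificate must satisfy: odd size; even exclusion counts for frozen positions in every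
group; even counts of «window counter hits 0 ∧ not excluded» for EVERY threshold `t ≤ 20`, base `L` and phase. -/
abbrev CertOKM (z : Fin 5 → Bool) (Λ : List ℕ) : Prop :=
  Λ.length % 2 = 1 ∧
    (∀ g : Fin 6, ∀ c : ZMod 3, (Λ.countP fun j => decide (c + sF z (εOf j) g.val ≠ 2)) % 2 = 0) ∧
    (∀ t : Fin 21, ∀ L : ZMod 3, ∀ c : ZMod 3,
      (Λ.countP fun j => decide (L + cntT5 t.val (εOf j) = 0) && decide (c + sF z (εOf j) 5 ≠ 2)) % 2 = 0)

/-- **CORE OF THE MULTI-COUNTER LAW (finite check, `decide`)**. -/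
theorem certOKM_lam5 : ∀ z₀ z₁ z₂ z₃ z₄ : Bool, z₂ = !z₁ → z₃ = !z₁ → z₄ = z₁ →
    CertOKM ![z₀, z₁, z₂, z₃, z₄] (lamM ![z₀, z₁, z₂, z₃, z₄]) := by
  intro z₀ z₁ z₂ z₃ z₄ h2 h3 h4
  rw [h2, h3, h4]
  cases z₀ <;> cases z₁ <;> decide

/-- ResponseDialHA helper `certOKM_lam` (decomp-qadv land package; see the module docstring). -/
theorem certOKM_lam (z : Fin 5 → Bool) (h2 : z 2 = !z 1) (h3 : z 3 = !z 1) (h4 : z 4 = z 1) :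
    CertOKM z (lamM z) := by
  have h := certOKM_lam5 (z 0) (z 1) (z 2) (z 3) (z 4) h2 h3 h4
  rw [← eq_vec5 z] at h
  exact h

/-- cells forced to `0` resp. `1` at the conditioned base points. -/
def JM0 : Finset ℕ := {3, 7, 11, 12, 15, 19}
/-- ResponseDialHA helper `JM1` (decomp-qadv land package; see the module docstring). -/
def JM1 : Finset ℕ := {8, 9, 10, 13, 14, 16, 17, 18}
/-- ResponseDialHA helper `JM` (decomp-qadv land package; see the module docstring). -/
def JM : Finset ℕ := {0, 3, 7, 8, 9, 10, 11, 12, 13, 14, 15, 16, 17, 18, 19}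

/-- ResponseDialHA helper `FixM` (decomp-qadv land package; see the module docstring). -/
def FixM (x : Fin N → Bool) : Prop :=
  (∀ j : Fin N, j.val ∈ JM0 → x j = false) ∧ (∀ j : Fin N, j.val ∈ JM1 → x j = true)


end MultiCounterLaw
end Summit.QuantumAdvantage.QuantumAdvantage.Theorems.ResponseDial
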